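import Literature.Analysis.FluidPDE.LocalTypeILscPressure
import Literature.Analysis.FluidPDE.PineauVicolOneSliceGradient
import Literature.Analysis.FluidPDE.SereginSverakBlowupLimit
import HarnessLib

/-!
# Route HardyPointSink — `HardyAncientLimit`, step 8a: the ball-average gauge of the
# rescaled pressures

Support file for item stmt-NavierStokesRegularity-9138 (`HardyAncientLimit`) of route
`HardyPointSink` (problem `NavierStokesRegularity`).

Along the blow-up sequence the rescaled pressures `q_k` are only controlled through
Albritton–Barker's *oscillation* quantity `D(Q(z,r); q) = r⁻² ∫∫ |q - [q]_{B(x,r)}|^{3/2}`. To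
extract weak `L^{3/2}_{loc}` limits one fixes the gauge by subtracting a function of time only,
the mean over the closed unit ball, `q̃(s, y) = q(s, y) - ⨍_{B̄(0,1)} q(s ∧ 0, ·)` (the time is
clamped to `s ≤ 0`, where the fields live, so that the gauge is a continuous function of `s`).
This file proves, for one continuous `q` on `{s ≤ 0} × ℝ³`:

* `HardyAncientLimit.continuous_ballMean` — the gauge function is continuous;
* `HardyAncientLimit.cknDOsc_sub_timeFun` — `D` is invariant under subtracting functions of time;
* `HardyAncientLimit.lintegral_gauged_rpow_le` — the level bound
  `∫∫_{Q(0,R)} |q̃|^{3/2} ≤ 2^{1/2} (1 + |B_R| |B̄₁|⁻¹) R² D(Q(0,R); q)` (Jensen for the mean);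
* `HardyAncientLimit.isDistributional_gauged` — `(U, q̃)` solves Navier–Stokes in `𝒟'` where
  `(U, q)` does (the pressure is determined up to a function of time, CKN 1982, §2).

## References

* D. Albritton, T. Barker, arXiv:1811.00502, §3 (proof of Thm. 1.1, the pressure decomposition).
* L. Caffarelli, R. Kohn, L. Nirenberg, CPAM 35 (1982), §2.
-/

noncomputable section

open Literature.Analysis.FluidPDE Literature.Analysis.FluidPDE.SereginSverak2009
open MeasureTheory Set Function Filter Topology Metric TopologicalSpace
open scoped ENNReal NNReal

namespace Summit.NavierStokesRegularity.NavierStokesRegularity.Theorems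

namespace HardyAncientLimit

variable {q : ℝ → EuclideanSpace ℝ (Fin 3) → ℝ}

/-- A time slice `q(s, ·)`, `s ≤ 0`, of a field continuous on `{s ≤ 0} × ℝ³` is continuous.
[folklore] -/
theorem continuous_slice_of_continuousOn
    (hq : ContinuousOn (uncurry q) (Iic 0 ×ˢ univ)) {s : ℝ} (hs : s ≤ 0) : Continuous (q s) := by
  have h1 : Continuous fun y : EuclideanSpace ℝ (Fin 3) => ((s, y) : ℝ × EuclideanSpace ℝ (Fin 3)) :=
    continuous_const.prodMk continuous_id
  exact hq.comp_continuous h1 fun y => ⟨hs, mem_univ _⟩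

/-- A time slice `q(s, ·)`, `s ≤ 0`, of a field continuous on `{s ≤ 0} × ℝ³` is integrable on
every bounded measurable set. [folklore] -/
theorem integrableOn_slice_of_continuousOn
    (hq : ContinuousOn (uncurry q) (Iic 0 ×ˢ univ)) {s : ℝ} (hs : s ≤ 0)
    {B : Set (EuclideanSpace ℝ (Fin 3))} (hB : Bornology.IsBounded B) :
    IntegrableOn (q s) B volume :=
  ((continuous_slice_of_continuousOn hq hs).continuousOn.integrableOn_compact
    hB.isCompact_closure).mono_set subset_closure

/-- **The ball-mean gauge is continuous.** For `q` continuous on `{s ≤ 0} × ℝ³`, the function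
`s ↦ ⨍_{B̄(0,1)} q(s ∧ 0, y) dy` is continuous on `ℝ` (a parametric integral of a continuous
function over a compact set). [folklore] -/
theorem continuous_ballMean (hq : ContinuousOn (uncurry q) (Iic 0 ×ˢ univ)) :
    Continuous fun s : ℝ =>
      ⨍ y in closedBall (0 : EuclideanSpace ℝ (Fin 3)) 1, q (min s 0) y := by
  have hc : Continuous (uncurry fun (s : ℝ) (y : EuclideanSpace ℝ (Fin 3)) => q (min s 0) y) := by
    have h1 : Continuous fun z : ℝ × EuclideanSpace ℝ (Fin 3) =>
        ((min z.1 0, z.2) : ℝ × EuclideanSpace ℝ (Fin 3)) := by fun_prop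
    exact hq.comp_continuous h1 fun z => ⟨(min_le_right z.1 0 : min z.1 0 ≤ 0), mem_univ _⟩
  have h := continuous_parametric_integral_of_continuous (μ := volume) hc
    (isCompact_closedBall (0 : EuclideanSpace ℝ (Fin 3)) 1)
  have e : (fun s : ℝ => ⨍ y in closedBall (0 : EuclideanSpace ℝ (Fin 3)) 1, q (min s 0) y) =
      fun s => ((volume : Measure (EuclideanSpace ℝ (Fin 3))).real
        (closedBall (0 : EuclideanSpace ℝ (Fin 3)) 1))⁻¹ •
          ∫ y in closedBall (0 : EuclideanSpace ℝ (Fin 3)) 1, q (min s 0) y := by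
    funext s
    exact setAverage_eq _ _ _
  rw [e]
  exact h.const_smul (((volume : Measure (EuclideanSpace ℝ (Fin 3))).real
    (closedBall (0 : EuclideanSpace ℝ (Fin 3)) 1))⁻¹)

/-- Subtracting a constant commutes with the mean over a set of finite positive measure, for an
integrable function. [folklore] -/
theorem setAverage_sub_const {B : Set (EuclideanSpace ℝ (Fin 3))} (hB0 : volume B ≠ 0)
    (hBt : volume B ≠ ⊤) {f : EuclideanSpace ℝ (Fin 3) → ℝ} (hf : IntegrableOn f B volume)
    (c : ℝ) : ⨍ y in B, (f y - c) = (⨍ y in B, f y) - c := by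
  haveI : IsFiniteMeasure (volume.restrict B) := ⟨by rwa [Measure.restrict_apply_univ, lt_top_iff_ne_top]⟩
  have hr : (volume : Measure (EuclideanSpace ℝ (Fin 3))).real B ≠ 0 := by
    rw [measureReal_def, ENNReal.toReal_ne_zero]
    exact ⟨hB0, hBt⟩
  rw [setAverage_eq, setAverage_eq, integral_sub hf (integrable_const c), setIntegral_const,
    smul_sub, smul_eq_mul, smul_eq_mul, smul_eq_mul, ← mul_assoc, inv_mul_cancel₀ hr, one_mul]

/-- **Gauge invariance of the mean-free part**: on a slice `s ≤ 0`,
`(q - c) - [q - c]_B = q - [q]_B` for every constant `c` and bounded `B` of positive measure.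
[folklore] -/
theorem sub_setAverage_sub_const (hq : ContinuousOn (uncurry q) (Iic 0 ×ˢ univ)) {s : ℝ}
    (hs : s ≤ 0) {B : Set (EuclideanSpace ℝ (Fin 3))} (hB : Bornology.IsBounded B)
    (hB0 : volume B ≠ 0) (c : ℝ) (y : EuclideanSpace ℝ (Fin 3)) :
    (q s y - c) - ⨍ y' in B, (q s y' - c) = q s y - ⨍ y' in B, q s y' := by
  rw [setAverage_sub_const hB0 hB.measure_lt_top.ne (integrableOn_slice_of_continuousOn hq hs hB) c]
  ring

/-- **`D` is invariant under subtracting a function of time.** For `q` continuous on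
`{s ≤ 0} × ℝ³`, any `c : ℝ → ℝ`, `r > 0` and `z` with `z.1 ≤ 0`,
`D(Q(z,r); q - c) = D(Q(z,r); q)`. [cite: AlbrittonBarker2019, §3] -/
theorem cknDOsc_sub_timeFun (hq : ContinuousOn (uncurry q) (Iic 0 ×ˢ univ)) (c : ℝ → ℝ)
    {r : ℝ} (hr : 0 < r) {z : ℝ × EuclideanSpace ℝ (Fin 3)} (hz : z.1 ≤ 0) :
    cknDOsc r z (fun t x => q t x - c t) = cknDOsc r z q := by
  unfold cknDOsc
  congr 1
  refine setLIntegral_congr_fun (isOpen_parabolicCylinder r z).measurableSet fun w hw => ?_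
  rw [mem_parabolicCylinder] at hw
  have hs : w.1 ≤ 0 := (hw.1.2.le).trans hz
  simp only
  rw [sub_setAverage_sub_const hq hs isBounded_ball (measure_ball_pos volume z.2 hr).ne' (c w.1) w.2]

/-- `Q(0, R) = (-R², 0) × B(0, R)` as a product set. [folklore] -/
theorem parabolicCylinder_zero_eq (R : ℝ) :
    parabolicCylinder R (0 : ℝ × EuclideanSpace ℝ (Fin 3)) =
      Ioo (-R ^ 2) 0 ×ˢ ball (0 : EuclideanSpace ℝ (Fin 3)) R := by
  rw [parabolicCylinder, Prod.fst_zero, Prod.snd_zero, zero_sub]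

/-- `‖a - b‖ₑ^{3/2} ≤ 2^{1/2} (‖a‖ₑ^{3/2} + ‖b‖ₑ^{3/2})` for reals. [folklore] -/
theorem enorm_sub_rpow_threeHalves_le (a b : ℝ) :
    ‖a - b‖ₑ ^ (3 / 2 : ℝ) ≤ 2 ^ (1 / 2 : ℝ) * (‖a‖ₑ ^ (3 / 2 : ℝ) + ‖b‖ₑ ^ (3 / 2 : ℝ)) := by
  have h1 : ‖a - b‖ₑ ≤ ‖a‖ₑ + ‖b‖ₑ := enorm_sub_le
  have h2 := ENNReal.rpow_add_le_mul_rpow_add_rpow ‖a‖ₑ ‖b‖ₑ (by norm_num : (1 : ℝ) ≤ 3 / 2)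
  have h3 : (3 / 2 : ℝ) - 1 = 1 / 2 := by norm_num
  rw [h3] at h2
  exact (ENNReal.rpow_le_rpow h1 (by norm_num)).trans h2

/-- **The level bound for the gauged pressure.** For `q` continuous on `{s ≤ 0} × ℝ³` and
`R > 1`, the gauged field `q̃(s,y) = q(s,y) - ⨍_{B̄(0,1)} q(s ∧ 0, ·)` satisfies
`∫∫_{Q(0,R)} |q̃|^{3/2} ≤ 2^{1/2} (1 + |B(0,R)| |B̄(0,1)|⁻¹) · R² D(Q(0,R); q)`: write
`q̃ = (q - [q]_{B_R}) - [q - [q]_{B_R}]_{B̄₁}` and bound the second term slice-wise by Jensen.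
[cite: AlbrittonBarker2019, §3 (the decomposition of the pressure)] -/
theorem lintegral_gauged_rpow_le (hq : ContinuousOn (uncurry q) (Iic 0 ×ˢ univ)) {R : ℝ}
    (hR : 1 < R) :
    ∫⁻ w in parabolicCylinder R (0 : ℝ × EuclideanSpace ℝ (Fin 3)),
        ‖q w.1 w.2 - ⨍ y in closedBall (0 : EuclideanSpace ℝ (Fin 3)) 1, q (min w.1 0) y‖ₑ ^
          (3 / 2 : ℝ) ≤
      2 ^ (1 / 2 : ℝ) * (1 + volume (ball (0 : EuclideanSpace ℝ (Fin 3)) R) *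
          (volume (closedBall (0 : EuclideanSpace ℝ (Fin 3)) 1))⁻¹) *
        (ENNReal.ofReal R ^ 2 * cknDOsc R 0 q) := by
  have hR0 : 0 < R := one_pos.trans hR
  set B₁ : Set (EuclideanSpace ℝ (Fin 3)) := closedBall 0 1 with hB₁
  set B : Set (EuclideanSpace ℝ (Fin 3)) := ball 0 R with hB
  set I : Set ℝ := Ioo (-R ^ 2) 0 with hI
  have hB₁0 : volume B₁ ≠ 0 := (measure_closedBall_pos volume (0 : EuclideanSpace ℝ (Fin 3)) one_pos).ne'
  have hB₁t : volume B₁ ≠ ⊤ := measure_closedBall_lt_top.ne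
  have hB0 : volume B ≠ 0 := (measure_ball_pos volume (0 : EuclideanSpace ℝ (Fin 3)) hR0).ne'
  have hBt : volume B ≠ ⊤ := measure_ball_lt_top.ne
  have hB₁B : B₁ ⊆ B := closedBall_subset_ball hR
  have hQ : parabolicCylinder R (0 : ℝ × EuclideanSpace ℝ (Fin 3)) = I ×ˢ B :=
    parabolicCylinder_zero_eq R
  -- the mean-free part `g = q - [q]_{B_R}` and the identity `R² D = ∫∫ |g|^{3/2}`
  set g : ℝ × EuclideanSpace ℝ (Fin 3) → ℝ := fun w => q w.1 w.2 - ⨍ y in B, q w.1 y with hg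
  have hD : ENNReal.ofReal R ^ 2 * cknDOsc R 0 q = ∫⁻ w in I ×ˢ B, ‖g w‖ₑ ^ (3 / 2 : ℝ) := by
    unfold cknDOsc
    rw [hQ, Prod.snd_zero, ENNReal.mul_inv_cancel_left
      (pow_ne_zero _ ((ENNReal.ofReal_pos.2 hR0).ne')) (ENNReal.pow_ne_top ENNReal.ofReal_ne_top)]
  -- measurability
  have hIB : I ×ˢ B ⊆ Iic (0 : ℝ) ×ˢ (univ : Set (EuclideanSpace ℝ (Fin 3))) :=
    prod_mono (fun s hs => hs.2.le) (subset_univ _)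
  have hqm : AEStronglyMeasurable (uncurry q) (volume.restrict (I ×ˢ B)) :=
    (hq.mono hIB).aestronglyMeasurable (measurableSet_Ioo.prod measurableSet_ball)
  have havm : AEStronglyMeasurable (fun w : ℝ × EuclideanSpace ℝ (Fin 3) => ⨍ y in B, q w.1 y)
      (volume.restrict (I ×ˢ B)) := aestronglyMeasurable_setAverage_slice hqm
  have hgm : AEStronglyMeasurable g (volume.restrict (I ×ˢ B)) := hqm.sub havm
  have hgm' : AEMeasurable (fun w => ‖g w‖ₑ ^ (3 / 2 : ℝ))
      ((volume.restrict I).prod (volume.restrict B)) := by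
    have := hgm.aemeasurable.enorm.pow_const (3 / 2 : ℝ)
    rwa [volume_restrict_prod_eq] at this
  -- pointwise: the gauged field is `g - [g(s, ·)]_{B̄₁}`
  have hpt : ∀ w ∈ I ×ˢ B, q w.1 w.2 - ⨍ y in B₁, q (min w.1 0) y =
      g w - ⨍ y in B₁, g (w.1, y) := by
    intro w hw
    have hs : w.1 ≤ 0 := (hw.1.2).le
    have hmin : min w.1 0 = w.1 := min_eq_left hs
    simp only [hg, hmin]
    rw [setAverage_sub_const hB₁0 hB₁t (integrableOn_slice_of_continuousOn hq hs isBounded_closedBall)]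
    ring
  -- slice-wise Jensen for the second term
  have hJ : ∀ s ∈ I, ‖⨍ y in B₁, g (s, y)‖ₑ ^ (3 / 2 : ℝ) ≤
      (volume B₁)⁻¹ * ∫⁻ y in B, ‖g (s, y)‖ₑ ^ (3 / 2 : ℝ) := by
    intro s hs
    have hs0 : s ≤ 0 := hs.2.le
    have hc : Continuous fun y => g (s, y) := by
      simp only [hg]
      exact (continuous_slice_of_continuousOn hq hs0).sub continuous_const
    refine (enorm_setAverage_rpow_le hB₁t (by norm_num : (1 : ℝ) ≤ 3 / 2)
      hc.aestronglyMeasurable).trans ?_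
    gcongr 1
    exact lintegral_mono_set hB₁B
  -- the second term
  have h2 : ∫⁻ w in I ×ˢ B, ‖⨍ y in B₁, g (w.1, y)‖ₑ ^ (3 / 2 : ℝ) ≤
      volume B * (volume B₁)⁻¹ * ∫⁻ w in I ×ˢ B, ‖g w‖ₑ ^ (3 / 2 : ℝ) := by
    rw [volume_restrict_prod_eq]
    refine (lintegral_prod_le _).trans ?_
    simp only [lintegral_const, Measure.restrict_apply_univ]
    rw [lintegral_prod _ hgm']
    calc ∫⁻ s in I, ‖⨍ y in B₁, g (s, y)‖ₑ ^ (3 / 2 : ℝ) * volume B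
        ≤ ∫⁻ s in I, volume B * (volume B₁)⁻¹ * ∫⁻ y in B, ‖g (s, y)‖ₑ ^ (3 / 2 : ℝ) := by
          refine lintegral_mono_ae ?_
          filter_upwards [ae_restrict_mem measurableSet_Ioo] with s hs
          calc ‖⨍ y in B₁, g (s, y)‖ₑ ^ (3 / 2 : ℝ) * volume B
              ≤ ((volume B₁)⁻¹ * ∫⁻ y in B, ‖g (s, y)‖ₑ ^ (3 / 2 : ℝ)) * volume B := by
                gcongr
                exact hJ s hs
            _ = volume B * (volume B₁)⁻¹ * ∫⁻ y in B, ‖g (s, y)‖ₑ ^ (3 / 2 : ℝ) := by ring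
      _ = volume B * (volume B₁)⁻¹ * ∫⁻ s in I, ∫⁻ y in B, ‖g (s, y)‖ₑ ^ (3 / 2 : ℝ) := by
          rw [lintegral_const_mul' _ _ (ENNReal.mul_ne_top hBt (ENNReal.inv_ne_top.2 hB₁0))]
  -- assemble
  have hA : AEMeasurable (fun w => ‖g w‖ₑ ^ (3 / 2 : ℝ)) (volume.restrict (I ×ˢ B)) :=
    hgm.aemeasurable.enorm.pow_const _
  calc ∫⁻ w in parabolicCylinder R (0 : ℝ × EuclideanSpace ℝ (Fin 3)),
        ‖q w.1 w.2 - ⨍ y in B₁, q (min w.1 0) y‖ₑ ^ (3 / 2 : ℝ)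
      = ∫⁻ w in I ×ˢ B, ‖g w - ⨍ y in B₁, g (w.1, y)‖ₑ ^ (3 / 2 : ℝ) := by
        rw [hQ]
        exact setLIntegral_congr_fun (measurableSet_Ioo.prod measurableSet_ball) fun w hw => by
          rw [hpt w hw]
    _ ≤ ∫⁻ w in I ×ˢ B, 2 ^ (1 / 2 : ℝ) * (‖g w‖ₑ ^ (3 / 2 : ℝ) +
          ‖⨍ y in B₁, g (w.1, y)‖ₑ ^ (3 / 2 : ℝ)) :=
        lintegral_mono fun w => enorm_sub_rpow_threeHalves_le _ _
    _ = 2 ^ (1 / 2 : ℝ) * ((∫⁻ w in I ×ˢ B, ‖g w‖ₑ ^ (3 / 2 : ℝ)) +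
          ∫⁻ w in I ×ˢ B, ‖⨍ y in B₁, g (w.1, y)‖ₑ ^ (3 / 2 : ℝ)) := by
        rw [lintegral_const_mul' _ _ (ENNReal.rpow_ne_top_of_nonneg (by norm_num) ENNReal.ofNat_ne_top),
          lintegral_add_left' hA]
    _ ≤ 2 ^ (1 / 2 : ℝ) * ((∫⁻ w in I ×ˢ B, ‖g w‖ₑ ^ (3 / 2 : ℝ)) +
          volume B * (volume B₁)⁻¹ * ∫⁻ w in I ×ˢ B, ‖g w‖ₑ ^ (3 / 2 : ℝ)) := by
        gcongr
    _ = 2 ^ (1 / 2 : ℝ) * (1 + volume B * (volume B₁)⁻¹) *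
          (ENNReal.ofReal R ^ 2 * cknDOsc R 0 q) := by
        rw [hD, mul_assoc (2 ^ (1 / 2 : ℝ) : ℝ≥0∞), add_mul, one_mul]

/-- **The gauged pressure solves the same equations.** If `(U, q)` solves Navier–Stokes in
`𝒟'(Q(R))` and `q` is continuous on `{s ≤ 0} × ℝ³`, then so does `(U, q̃)` with the ball-mean
gauge `q̃(s,y) = q(s,y) - ⨍_{B̄(0,1)} q(s ∧ 0, ·)` (a continuous function of time only is
subtracted). [cite: CaffarelliKohnNirenberg1982, §2] -/
theorem isDistributional_gauged (hq : ContinuousOn (uncurry q) (Iic 0 ×ˢ univ))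
    {U : ℝ → EuclideanSpace ℝ (Fin 3) → EuclideanSpace ℝ (Fin 3)} {R : ℝ}
    (h : IsDistributionalNSSolutionOn (parCylOpens 0 R) 1 0 U q) :
    IsDistributionalNSSolutionOn (parCylOpens 0 R) 1 0 U fun s y =>
      q s y - ⨍ y' in closedBall (0 : EuclideanSpace ℝ (Fin 3)) 1, q (min s 0) y' :=
  h.sub_timeFun (((continuous_ballMean hq).comp continuous_fst).locallyIntegrable.locallyIntegrableOn _)

/-- The gauged pressure is continuous on `{s ≤ 0} × ℝ³`. [folklore] -/
theorem continuousOn_gauged (hq : ContinuousOn (uncurry q) (Iic 0 ×ˢ univ)) :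
    ContinuousOn (uncurry fun s y =>
      q s y - ⨍ y' in closedBall (0 : EuclideanSpace ℝ (Fin 3)) 1, q (min s 0) y')
      (Iic 0 ×ˢ univ) :=
  hq.sub ((continuous_ballMean hq).comp continuous_fst).continuousOn

/-- `D` of the gauged pressure equals `D` of the pressure (on balls below `s = 0`).
[cite: AlbrittonBarker2019, §3] -/
theorem cknDOsc_gauged (hq : ContinuousOn (uncurry q) (Iic 0 ×ˢ univ)) {r : ℝ} (hr : 0 < r)
    {z : ℝ × EuclideanSpace ℝ (Fin 3)} (hz : z.1 ≤ 0) :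
    cknDOsc r z (fun s y =>
      q s y - ⨍ y' in closedBall (0 : EuclideanSpace ℝ (Fin 3)) 1, q (min s 0) y') =
      cknDOsc r z q :=
  cknDOsc_sub_timeFun hq _ hr hz

end HardyAncientLimit

end Summit.NavierStokesRegularity.NavierStokesRegularity.Theorems

end
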